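/-
Speedrun cell sr-mbsolver / programme hubbard-alg — LIT team (lit-1 gen-15): THEOREM B, `jw-srot` form, for the RAWLOW relaxation with raw block
`ρ₅` (FORMAT-ksdn v0.5 `mps-rawlow`, χ8: `m₀ = 6`, injection `W₄`, bound rule `lmax_psd`) — the kernel edge that the Lean cell of CERTIFIED #349
(and every later χ8 rawlow row) needs between its by-value node and the window level. Theorem-only; T2 of
`HOME/sr-mbsolver-lit-1/lean/g15/READY-LEAN-349.md`.
HONEST FRAMING: first certified bounds; not a superconductivity verdict; every number certified or labelled float.

`ksdnSrotClaim_of_mpsRaw5SrotTrClaim` = `ksdnSrotClaim_of_mpsSrotTrClaim` (`Transport/MPSPrimalSrotTrace.lean`) VERBATIM with the raw head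
block `ρ₃` on `{-1,0,1}` replaced by `ρ₅` on `{-1,…,3}` (coordinates `e₅ : Fin 5 ≃ {-1,…,3}`, `i ↦ i − 1`), the injection `W₂` by `W₄ = cgMap A 4`,
the compressed levels `ω₄…ω_N` by `ω₆…ω_N` (chain rows from `m = 7`), and the a-priori bound hypothesis in the `λ_max` (Löwner) form
`W_{m−2}ᴴ W_{m−2} ≤ B_m·𝟙` of the `.lmax` instances; the feasible point is `exists_mpsRawRowsTr_of_window_loewner 4`
(`Transport/MPSPrimalRawWindow.lean`). Window `N = n + 3 ≥ 6`. No model beyond `jw-srot`, no definition, no `sorry`, no new axiom, no named fact.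
[cite: KullEtAl2024, §2.3–2.5, §4.2, §6.2] [cite: ArakiMoriya2003, §4.1]
-/
import Summits.Ventures.CertifiedManyBodySolver.Transport.MPSPrimalRawWindow
import HarnessLib

noncomputable section

open Matrix Complex Filter Topology
open scoped ComplexOrder Kronecker BigOperators MatrixOrder
open Literature.Probability.LatticeModels
open Literature.MathematicalPhysics.QuantumLattice
open Literature.MathematicalPhysics.QuantumLattice.HubbardWave0
open Literature.MathematicalPhysics.QuantumLattice.ThermodynamicLimit
open Literature.MathematicalPhysics.QuantumLattice.JordanWigner
open Literature.MathematicalPhysics.QuantumManyBody.StateRelaxation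
open Literature.MathematicalPhysics.QuantumLattice.MPSCoarseGraining
open Literature.Computability.QuantumComplexity (traceLeft traceRight)

namespace Summit.Ventures.CertifiedManyBodySolver.Transport

/-! ### The five-site raw window `{-1, 0, 1, 2, 3}` -/

section Window5

/-- `{-1,…,2} ⊆ {-1,…,3}`. [folklore] -/
theorem chainWindow_two_subset_three : chainWindow (-1) 2 ⊆ chainWindow (-1) 3 := chainWindow_mono_right (-1) (by norm_num)

/-- The unit translate of `{-1,…,2}` lies in `{-1,…,3}`. [folklore] -/
theorem affShiftSet_chainWindow_two_subset_three : affShiftSet 1 (unitVec 0) (chainWindow (-1) 2) ⊆ chainWindow (-1) 3 :=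
  affShiftSet_chainWindow_subset (-1) 2

/-- `-e₀ ∈ {-1,…,3}`. [folklore] -/
theorem neg_unitVec_mem_chainWindow_three : (-unitVec 0 : Site 1) ∈ chainWindow (-1) 3 := neg_unitVec_mem_chainWindow (by norm_num)

/-- `0 ∈ {-1,…,3}`. [folklore] -/
theorem zero_mem_chainWindow_three : (0 : Site 1) ∈ chainWindow (-1) 3 := zero_mem_chainWindow (by norm_num)

end Window5

/-! ### THEOREM B, `jw-srot` form, RAWLOW with raw block `ρ₅`: the `mps-rawlow(N, D, A)` statement implies the `jw-srot` window statement -/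

section Transport

variable {β : Type*} [Fintype β] [DecidableEq β]

/-- **THEOREM B, `jw-srot` form, RAWLOW (`ρ₅`, `W₄`, `λ_max` bounds), edge form.** Data: window `N = n+3 ≥ 6` sites; a REAL MPS tensor
`A = (A^s)_{s ∈ Fin 4}` on the bond index type `β`, CHARGE COVARIANT for `q_eff(s) = cb·|occ(s)| − ca` with bond charges `qb : β → ℤ`; a-priori
bounds `B_m ≥ 0` with `W_{m−2}ᴴW_{m−2} ≤ B_m·𝟙` (`m = k+6 ≤ N`); coordinates `e₅ : Fin 5 ≃ {-1,…,3}`, `i ↦ i − 1`. HYPOTHESIS `hclaim` = the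
by-value node of a `hubbard_jwsrot` `mps-rawlow` row: over `ρ₅ : Op (PolySite {-1,…,3}) 4` and `ω₆, …, ω_N` — `ρ₅ ⪰ 0`, `tr ρ₅ = 1`, LTI
`tr_{-1} ρ₅ = tr_{3} ρ₅`, TOTAL-OCCUPATION sector zeros, total density of site `-1` equal to `ν`, real entries, `|ρ₅| ≤ 1`; E6L/E6R with `ρ₅` read
through `e₅` then as (first four, last) / (first, last four) and `W₄ = cgMap A 4`; E_mL/E_mR (`m = k+7 ≤ N`); `ω_m ⪰ 0`, `cgTag q_eff qb` sectors,
real, `|ω_m| ≤ B_m`, `Re tr ω_m ≤ B_m` (`m = k+6 ≤ N`); conclusion `E ≤ Re tr(toSpin(U n_{-1↑}n_{-1↓} − t Σ_σ (c†_{-1σ} c_{0σ̄} + c†_{0σ̄} c_{-1σ})) ρ₅)`.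
CONCLUSION: the hypothesis `hclaim` of `Transport.ksdnClaim_of_srotClaim` on `{-1, …, n+1}` with density `ν` (the `jw-srot` window statement).
[cite: KullEtAl2024, §2.3–2.5, §4.2, §6.2] [cite: ArakiMoriya2003, §4.1] -/
theorem ksdnSrotClaim_of_mpsRaw5SrotTrClaim (t U : ℝ) (n : ℕ) (hn : 3 ≤ n) (A : Fin 4 → Matrix β β ℂ)
    (hAreal : ∀ s a b, star (A s a b) = A s a b) (qb : β → ℤ) (cb ca : ℤ)
    (hAcov : ∀ s a b, A s a b ≠ 0 → qb b = qb a + (fun s : Fin 4 => cb * ((siteOcc s).card : ℤ) - ca) s)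
    (B : ℕ → ℝ) (hB : ∀ k, k + 6 ≤ n + 3 → 0 ≤ B (k + 6) ∧
      (cgMap A (k + 4))ᴴ * cgMap A (k + 4) ≤ B (k + 6) • (1 : Matrix (Fin (k + 4) → Fin 4) (Fin (k + 4) → Fin 4) ℂ))
    (e₅ : Fin 5 ≃ PolySite (chainWindow (-1) 3)) (he₅ : ∀ i, ofLex (e₅ i).1 0 = ((i : ℕ) : ℤ) - 1)
    {ν E : ℝ}
    (hclaim : ∀ (ρ₅ : Op (PolySite (chainWindow (-1) 3)) 4)
        (ω : ℕ → Matrix (Fin 4 × ((β × β) × Fin 4)) (Fin 4 × ((β × β) × Fin 4)) ℂ),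
      ρ₅.PosSemidef → ρ₅.trace = 1 →
      spinPartialTrace ((PolySite.affEmb 1 (unitVec 0) (chainWindow (-1) 2)).trans
          (PolySite.incl affShiftSet_chainWindow_two_subset_three)) ρ₅ =
        spinPartialTrace (PolySite.incl chainWindow_two_subset_three) ρ₅ →
      (∀ k k' : TensorIndex (PolySite (chainWindow (-1) 3)) 4,
        (∑ x, (siteOcc (k x)).card) ≠ (∑ x, (siteOcc (k' x)).card) → ρ₅ k k' = 0) →
      ((toSpin (nAt (-unitVec 0) neg_unitVec_mem_chainWindow_three 0 +
          nAt (-unitVec 0) neg_unitVec_mem_chainWindow_three 1) * ρ₅).trace).re = ν →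
      (∀ k k' : TensorIndex (PolySite (chainWindow (-1) 3)) 4, starRingEnd ℂ (ρ₅ k k') = ρ₅ k k') →
      (∀ k k' : TensorIndex (PolySite (chainWindow (-1) 3)) 4, ‖ρ₅ k k'‖ ≤ 1) →
      traceLeft (ω 6) = (cgMap A 4 ⊗ₖ (1 : Matrix (Fin 4) (Fin 4) ℂ)) *
          (ρ₅.submatrix (Equiv.arrowCongr e₅ (Equiv.refl (Fin 4))) (Equiv.arrowCongr e₅ (Equiv.refl (Fin 4)))).submatrix
            ((Equiv.prodComm _ _).trans (Fin.snocEquiv fun _ => Fin 4))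
            ((Equiv.prodComm _ _).trans (Fin.snocEquiv fun _ => Fin 4)) *
        (cgMap A 4 ⊗ₖ (1 : Matrix (Fin 4) (Fin 4) ℂ))ᴴ →
      traceRight ((ω 6).submatrix (Equiv.prodAssoc _ _ _) (Equiv.prodAssoc _ _ _)) =
        ((1 : Matrix (Fin 4) (Fin 4) ℂ) ⊗ₖ cgMap A 4) *
          (ρ₅.submatrix (Equiv.arrowCongr e₅ (Equiv.refl (Fin 4))) (Equiv.arrowCongr e₅ (Equiv.refl (Fin 4)))).submatrix
            (Fin.consEquiv fun _ => Fin 4) (Fin.consEquiv fun _ => Fin 4) *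
        ((1 : Matrix (Fin 4) (Fin 4) ℂ) ⊗ₖ cgMap A 4)ᴴ →
      (∀ k, k + 7 ≤ n + 3 → traceLeft (ω (k + 7)) =
        (leftMap A ⊗ₖ (1 : Matrix (Fin 4) (Fin 4) ℂ)) *
          (ω (k + 6)).submatrix (Equiv.prodAssoc _ _ _) (Equiv.prodAssoc _ _ _) *
        (leftMap A ⊗ₖ (1 : Matrix (Fin 4) (Fin 4) ℂ))ᴴ) →
      (∀ k, k + 7 ≤ n + 3 → traceRight ((ω (k + 7)).submatrix (Equiv.prodAssoc _ _ _) (Equiv.prodAssoc _ _ _)) =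
        ((1 : Matrix (Fin 4) (Fin 4) ℂ) ⊗ₖ rightMap A) * ω (k + 6) *
        ((1 : Matrix (Fin 4) (Fin 4) ℂ) ⊗ₖ rightMap A)ᴴ) →
      (∀ k, k + 6 ≤ n + 3 → (ω (k + 6)).PosSemidef) →
      (∀ k, k + 6 ≤ n + 3 → ∀ i j,
        cgTag (fun s : Fin 4 => cb * ((siteOcc s).card : ℤ) - ca) qb i ≠
        cgTag (fun s : Fin 4 => cb * ((siteOcc s).card : ℤ) - ca) qb j → ω (k + 6) i j = 0) →
      (∀ k, k + 6 ≤ n + 3 → ∀ i j, starRingEnd ℂ (ω (k + 6) i j) = ω (k + 6) i j) →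
      (∀ k, k + 6 ≤ n + 3 → ∀ i j, ‖ω (k + 6) i j‖ ≤ B (k + 6)) →
      (∀ k, k + 6 ≤ n + 3 → ((ω (k + 6)).trace).re ≤ B (k + 6)) →
      E ≤ ((toSpin ((U : ℂ) • (nAt (-unitVec 0) neg_unitVec_mem_chainWindow_three 0 *
            nAt (-unitVec 0) neg_unitVec_mem_chainWindow_three 1) +
          (-(t : ℂ)) • ∑ σ : Fin 2,
            ((cAt (-unitVec 0) neg_unitVec_mem_chainWindow_three σ)ᴴ *
                cAt 0 zero_mem_chainWindow_three σ.rev +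
              (cAt 0 zero_mem_chainWindow_three σ.rev)ᴴ *
                cAt (-unitVec 0) neg_unitVec_mem_chainWindow_three σ)) * ρ₅).trace).re) :
    ∀ ρ : Op (PolySite (chainWindow (-1) ((n : ℤ) + 1))) 4, ρ.PosSemidef → ρ.trace = 1 →
      spinPartialTrace ((PolySite.affEmb 1 (unitVec 0) (chainWindow (-1) (n : ℤ))).trans
          (PolySite.incl (affShiftSet_chainWindow_subset (-1) (n : ℤ)))) ρ =
        spinPartialTrace (PolySite.incl (chainWindow_mono_right (-1) (by omega : (n : ℤ) ≤ n + 1))) ρ →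
      (∀ k k' : TensorIndex (PolySite (chainWindow (-1) ((n : ℤ) + 1))) 4,
        (∑ x, (siteOcc (k x)).card) ≠ (∑ x, (siteOcc (k' x)).card) → ρ k k' = 0) →
      ((toSpin (nAt (-unitVec 0) (neg_unitVec_mem_chainWindow (by omega : (-1 : ℤ) ≤ n + 1)) 0 +
          nAt (-unitVec 0) (neg_unitVec_mem_chainWindow (by omega : (-1 : ℤ) ≤ n + 1)) 1) * ρ).trace).re = ν →
      (∀ k k' : TensorIndex (PolySite (chainWindow (-1) ((n : ℤ) + 1))) 4, starRingEnd ℂ (ρ k k') = ρ k k') →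
      (∀ k k' : TensorIndex (PolySite (chainWindow (-1) ((n : ℤ) + 1))) 4, ‖ρ k k'‖ ≤ 1) →
      E ≤ ((toSpin ((U : ℂ) • (nAt (-unitVec 0) (neg_unitVec_mem_chainWindow (by omega : (-1 : ℤ) ≤ n + 1)) 0 *
            nAt (-unitVec 0) (neg_unitVec_mem_chainWindow (by omega : (-1 : ℤ) ≤ n + 1)) 1) +
          (-(t : ℂ)) • ∑ σ : Fin 2,
            ((cAt (-unitVec 0) (neg_unitVec_mem_chainWindow (by omega : (-1 : ℤ) ≤ n + 1)) σ)ᴴ *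
                cAt 0 (zero_mem_chainWindow (by omega : (0 : ℤ) ≤ n + 1)) σ.rev +
              (cAt 0 (zero_mem_chainWindow (by omega : (0 : ℤ) ≤ n + 1)) σ.rev)ᴴ *
                cAt (-unitVec 0) (neg_unitVec_mem_chainWindow (by omega : (-1 : ℤ) ≤ n + 1)) σ)) * ρ).trace).re := by
  intro ρ hpsd htr hLTI hsec hdens hreal _hbd
  classical
  -- the windows `W₃ = {-1,0,1} ⊆ W = {-1,…,n+1}` and the shifts of the LTI embeddings
  have hW5 : chainWindow (-1) 3 ⊆ chainWindow (-1) ((n : ℤ) + 1) := chainWindow_mono_right (-1) (by omega)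
  have hlow5 : IsLowerSet (Set.range (PolySite.incl hW5)) := isLowerSet_range_incl_chainWindow hW5
  have hφ₀ := shift_incl (chainWindow_mono_right (-1) (by omega : (n : ℤ) ≤ n + 1))
  have hφ₁ : ∀ y, ofLex (((PolySite.affEmb 1 (unitVec 0) (chainWindow (-1) (n : ℤ))).trans
      (PolySite.incl (affShiftSet_chainWindow_subset (-1) (n : ℤ)))) y).1 0 = ofLex y.1 0 + 1 := fun y => by
    rw [shift_affEmb_trans_incl, chain_unitVec_apply_zero]
  -- (i) coordinates and the relabelled window variable `ρ^F`
  obtain ⟨eN, heN⟩ := exists_finEquiv_chainWindow (n + 3) ((n : ℤ) + 1) (by push_cast; ring)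
  obtain ⟨e', he'⟩ := exists_finEquiv_chainWindow (n + 2) (n : ℤ) (by push_cast; ring)
  set ρF : Op (Fin (n + 3)) 4 := spinPartialTrace eN.toEmbedding ρ with hρFdef
  have hFpsd : ρF.PosSemidef := posSemidef_spinPartialTrace _ hpsd
  have hFtr : ρF.trace = 1 := by rw [hρFdef, trace_spinPartialTrace, htr]
  have hsucc : (Fin.succEmb (n + 2)).trans eN.toEmbedding =
      e'.toEmbedding.trans ((PolySite.affEmb 1 (unitVec 0) (chainWindow (-1) (n : ℤ))).trans
        (PolySite.incl (affShiftSet_chainWindow_subset (-1) (n : ℤ)))) := by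
    refine embedding_eq_of_coord_eq fun i => ?_
    rw [Function.Embedding.trans_apply, Function.Embedding.trans_apply, Equiv.coe_toEmbedding, Equiv.coe_toEmbedding, heN,
      hφ₁, he', Fin.coe_succEmb, Fin.val_succ]
    push_cast
    ring
  have hcast : (Fin.castSuccEmb : Fin (n + 2) ↪ Fin (n + 3)).trans eN.toEmbedding =
      e'.toEmbedding.trans (PolySite.incl (chainWindow_mono_right (-1) (by omega : (n : ℤ) ≤ n + 1))) := by
    refine embedding_eq_of_coord_eq fun i => ?_
    rw [Function.Embedding.trans_apply, Function.Embedding.trans_apply, Equiv.coe_toEmbedding, Equiv.coe_toEmbedding, heN,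
      hφ₀, he', Fin.coe_castSuccEmb, Fin.val_castSucc, add_zero]
  have hFLTI : spinPartialTrace (Fin.succEmb (n + 2)) ρF = spinPartialTrace Fin.castSuccEmb ρF := by
    rw [hρFdef, ← spinPartialTrace_trans, ← spinPartialTrace_trans, hsucc, hcast, spinPartialTrace_trans e'.toEmbedding,
      spinPartialTrace_trans e'.toEmbedding, hLTI]
  have hFsecN : ∀ k k' : TensorIndex (Fin (n + 3)) 4,
      (∑ x, (siteOcc (k x)).card) ≠ (∑ x, (siteOcc (k' x)).card) → ρF k k' = 0 :=
    fun k k' h => spinPartialTrace_apply_eq_zero_of_charge (fun s : Fin 4 => (siteOcc s).card) eN.toEmbedding hsec h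
  have hFsec : ∀ u v : TensorIndex (Fin (n + 3)) 4,
      (∑ x, (fun s : Fin 4 => cb * ((siteOcc s).card : ℤ) - ca) (u x)) ≠
        (∑ x, (fun s : Fin 4 => cb * ((siteOcc s).card : ℤ) - ca) (v x)) → ρF u v = 0 :=
    fun u v huv => apply_eq_zero_of_sum_srotCharge_ne cb ca hFsecN u v huv
  have hFstar : ∀ u v, star (ρF u v) = ρF u v := fun u v => by
    have := conj_spinPartialTrace_apply eN.toEmbedding hreal u v
    rwa [starRingEnd_apply] at this
  -- (ii) the model-independent core: KSDN's `ω_m = C_{m−2}(ρ^F|_{first m})`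
  obtain ⟨ω, hE4L, hE4R, hEmL, hEmR, hωpsd, hωsec, hωreal, hωbd, hωtr⟩ :=
    exists_mpsRawRowsTr_of_window_loewner 4 (n + 1) (by norm_num) (show 4 ≤ n + 1 by omega) A hAreal _ qb hAcov B hB ρF hFpsd hFtr hFLTI hFsec hFstar
  -- (iii) the five-site marginal `ρ₅` and its rows
  set ρ₅ : Op (PolySite (chainWindow (-1) 3)) 4 := spinPartialTrace (PolySite.incl hW5) ρ with hρ₅def
  have h5psd : ρ₅.PosSemidef := posSemidef_spinPartialTrace _ hpsd
  have h5tr : ρ₅.trace = 1 := by rw [hρ₅def, trace_spinPartialTrace, htr]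
  have h5LTI : spinPartialTrace ((PolySite.affEmb 1 (unitVec 0) (chainWindow (-1) 2)).trans
        (PolySite.incl affShiftSet_chainWindow_two_subset_three)) ρ₅ =
      spinPartialTrace (PolySite.incl chainWindow_two_subset_three) ρ₅ := by
    rw [hρ₅def, ← spinPartialTrace_trans, ← spinPartialTrace_trans]
    refine spinPartialTrace_eq_of_shift hφ₀ hφ₁ hLTI 1 ?_ ?_
    · intro y
      rw [shift_trans (shift_affEmb_trans_incl (unitVec (0 : Fin 1)) affShiftSet_chainWindow_two_subset_three)
        (shift_incl hW5), chain_unitVec_apply_zero]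
      push_cast
      ring
    · intro y
      rw [shift_trans (shift_incl chainWindow_two_subset_three) (shift_incl hW5), add_zero]
  have h5sec : ∀ k k' : TensorIndex (PolySite (chainWindow (-1) 3)) 4,
      (∑ x, (siteOcc (k x)).card) ≠ (∑ x, (siteOcc (k' x)).card) → ρ₅ k k' = 0 :=
    fun k k' h => spinPartialTrace_apply_eq_zero_of_charge (fun s : Fin 4 => (siteOcc s).card) (PolySite.incl hW5) hsec h
  have h5dens : ((toSpin (nAt (-unitVec 0) neg_unitVec_mem_chainWindow_three 0 +
      nAt (-unitVec 0) neg_unitVec_mem_chainWindow_three 1) * ρ₅).trace).re = ν := by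
    rw [hρ₅def, trace_toSpin_mul_spinPartialTrace_incl hW5 hlow5, fermionEmbed_add, fermionEmbed_incl_nAt,
      fermionEmbed_incl_nAt]
    exact hdens
  have h5real : ∀ k k' : TensorIndex (PolySite (chainWindow (-1) 3)) 4, starRingEnd ℂ (ρ₅ k k') = ρ₅ k k' :=
    fun k k' => conj_spinPartialTrace_apply (PolySite.incl hW5) hreal k k'
  have h5bd : ∀ k k' : TensorIndex (PolySite (chainWindow (-1) 3)) 4, ‖ρ₅ k k'‖ ≤ 1 :=
    norm_apply_le_one_of_posSemidef h5psd h5tr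
  -- `ρ^F|_{first 5}` is `ρ₅` read through `e₅`
  have hemb : (Fin.castLEEmb (show 4 + 1 ≤ n + 3 by omega)).trans eN.toEmbedding =
      e₅.toEmbedding.trans (PolySite.incl hW5) := by
    refine embedding_eq_of_coord_eq fun i => ?_
    rw [Function.Embedding.trans_apply, Function.Embedding.trans_apply, Equiv.coe_toEmbedding, Equiv.coe_toEmbedding, heN,
      Fin.castLEEmb_apply, Fin.val_castLE]
    change _ = ofLex (e₅ i).1 0
    rw [he₅]
  have hlink : headMarginal (show 4 + 1 ≤ n + 1 + 2 by omega) ρF =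
      ρ₅.submatrix (Equiv.arrowCongr e₅ (Equiv.refl (Fin 4))) (Equiv.arrowCongr e₅ (Equiv.refl (Fin 4))) := by
    rw [headMarginal, hρFdef, ← spinPartialTrace_trans, hemb, spinPartialTrace_trans, spinPartialTrace_equiv]
    ext u v
    rw [reindexOp_apply, Matrix.submatrix_apply]
    rfl
  rw [hlink] at hE4L hE4R
  -- (iv) apply the `mps` claim and move the objective back to the big window
  have hE := hclaim ρ₅ ω h5psd h5tr h5LTI h5sec h5dens h5real h5bd hE4L hE4R hEmL hEmR hωpsd hωsec hωreal hωbd hωtr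
  rw [hρ₅def, trace_toSpin_mul_spinPartialTrace_incl hW5 hlow5] at hE
  simp only [fermionEmbed_add, fermionEmbed_smul, fermionEmbed_sum, fermionEmbed_mul, fermionEmbed_conjTranspose,
    fermionEmbed_incl_nAt, fermionEmbed_incl_cAt] at hE
  exact hE

end Transport

end Summit.Ventures.CertifiedManyBodySolver.Transport

end
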